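import Mathlib
import HarnessLib
import Literature.Algebra.Polynomial.ChebyshevPowerExpansion

/-!
# Chebyshev coefficients of `x^n`-type data: Rivlin, Exercises 1.2.6, 1.2.12, 1.2.16

Source: T. J. Rivlin, *The Chebyshev Polynomials*, Wiley 1974 (held scan
`book:rivlinnd-chebyshev-polynomials`, bib key `Rivlin1974`), Sect. 1.2, Exercises, p. 10 of the
scan.

The text.
* Ex. 1.2.6: every `p(x) = a_0 + ⋯ + a_n x^n` can be written `p = b_0 + b_1 T_1 + ⋯ + b_n T_n`, and
  `b_n = 2^{-(n-1)} a_n`.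
* Ex. 1.2.12: if `(T_n)^{2k+1} = B_0 + B_1 T_1 + ⋯ + B_{n(2k+1)} T_{n(2k+1)}` then
  `B_0 = B_1 = ⋯ = B_{n-1} = 0` (hint: `T_n^{2k} = ((1 + T_{2n})/2)^k` by Ex. 1.1.3, then Ex. 1.1.3
  repeatedly).
* Ex. 1.2.16: with `T_n(x) = Σ_k t_k^{(n)} x^k`, `s_k^{(n)} = t_0^{(n)} + ⋯ + t_k^{(n)}` and
  `q(x) = s_0 + s_1 x + ⋯ + s_n x^n`, one has `(1 - x) q(x) = T_n(x) - x^{n+1}`.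

What is here (over Mathlib's `Polynomial.Chebyshev.T`; the existence half of Ex. 1.2.6 is the
tree's `Literature.Algebra.Polynomial.ChebyshevPowerExpansion.eq_sum_coeff_mul_sum_T` / Mathlib's
basis facts and is cited, not restated; Ex. 1.1.3 is Mathlib's `Polynomial.Chebyshev.T_mul_T`).
* `natDegree_T_le`: `deg T_n ≤ n` over every commutative ring (Mathlib's `natDegree_T` needs a
  domain with `2 ≠ 0`); `sum_coeff_T_eq_one`: `Σ_k t_k^{(n)} = T_n(1) = 1`.
* Ex. 1.2.6, coefficient half: `coeff_sum_C_mul_chebyshevT` — the `x^n`-coefficient of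
  `Σ_{j ≤ n} b_j T_j` is `2^{n-1} b_n` (so `b_n = 2^{-(n-1)} a_n`), and the reading
  `coeff_eq_of_eq_sum_C_mul_chebyshevT`.
* Ex. 1.2.12: the hint `two_mul_T_sq` (`2 T_n² = 1 + T_{2n}`), `two_pow_mul_T_pow_two_mul`
  (`2^k T_n^{2k} = (1 + T_{2n})^k`); the full expansion `two_mul_T_pow_eq_sum`
  (`(2 T_n)^m = Σ_{i ≤ m} C(m, i) T_{(m-2i) n}`, `ℤ`-indexed, from the tree's Ex. 1.5.31 form of
  `(2x)^m` composed with `T_n` via `T_{ab} = T_a ∘ T_b`); and the conclusion in orthogonality form: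
  since the Chebyshev coefficient `B_j` of `p` is `(2/π) ∫ p T_j dμ_T` (Mathlib's `measureT`,
  `integral_eval_T_real_mul_eval_T_real_measureT_of_ne`), `B_j = 0` for `j < n` is
  `integral_T_pow_odd_mul_T_measureT_eq_zero`: `∫ T_n^{2k+1} T_j dμ_T = 0` for `j < n`
  (via `integral_T_mul_T_measureT_eq_zero`, `integral_two_mul_T_pow_mul_T_measureT`).
* Ex. 1.2.16: the general partial-sum identity `one_sub_X_mul_sum_partialSum`
  (`(1 - X) Σ_{k ≤ n} S_k X^k = Σ_{k ≤ n} a_k X^k - S_n X^{n+1}`, `S_k = a_0 + ⋯ + a_k`), its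
  polynomial reading `one_sub_X_mul_sum_partialSum_coeff` (`= p - p(1) X^{n+1}` when `deg p ≤ n`)
  and Rivlin's statement `one_sub_X_mul_sum_partialSum_T`.

NOT typed: Ex. 1.2.17–1.2.19 (zero counting / Descartes' rule for `T_n(x) - x^{n+1}` and the sign
alternation of `s_{n-2j}^{(n)}`).

Honest framing: shared numerical engines serving client cells; rigour lives in the verifiers; every
published number belongs to a client cell's ledger, not to the engines group.
-/

open Polynomial Polynomial.Chebyshev Finset MeasureTheory

namespace Literature.Analysis.Approximation.ChebyshevCoefficientExercises

section CommRing

variable (R : Type*) [CommRing R]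

/-! ### Degree bound and coefficient sum of `T_n` over any commutative ring -/

/-- `deg T_n ≤ n` over every commutative ring (the recurrence (1.4) `T_{n+2} = 2x T_{n+1} - T_n`).
[cite: Rivlin1974, Sect. 1.1 (1.4); Sect. 1.2 (1.10)] -/
theorem natDegree_T_le : ∀ n : ℕ, (T R n).natDegree ≤ n
  | 0 => by simp
  | 1 => by simpa using natDegree_X_le (R := R)
  | (n + 2) => by
    have h1 := natDegree_T_le (n + 1)
    have h0 := natDegree_T_le n
    have hT : T R ((n + 2 : ℕ) : ℤ) = 2 * X * T R ((n + 1 : ℕ) : ℤ) - T R (n : ℤ) := by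
      have := T_add_two R (n : ℤ)
      push_cast at this ⊢
      exact this
    rw [hT]
    refine (natDegree_sub_le _ _).trans (max_le ?_ (h0.trans (by omega)))
    refine (natDegree_mul_le).trans ?_
    have h2 : ((2 : R[X]) * X).natDegree ≤ 1 :=
      natDegree_mul_le.trans (by simpa using natDegree_X_le (R := R))
    omega

/-- With `T_n(x) = Σ_{k ≤ n} t_k^{(n)} x^k`: `t_0^{(n)} + ⋯ + t_n^{(n)} = T_n(1) = 1`, i.e.
`s_n^{(n)} = 1` in the notation of Ex. 1.2.16. [cite: Rivlin1974, Sect. 1.2 Ex. 1.2.16; (1.10)] -/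
theorem sum_coeff_T_eq_one (n : ℕ) : ∑ i ∈ range (n + 1), (T R n).coeff i = 1 := by
  have h := eval_eq_sum_range' (Nat.lt_succ_of_le (natDegree_T_le R n)) (1 : R)
  simpa using h.symm

/-! ### Ex. 1.2.6: the top Chebyshev coefficient is `2^{-(n-1)} a_n` -/

/-- Ex. 1.2.6 (coefficient half): the coefficient of `x^n` in `b_0 + b_1 T_1 + ⋯ + b_n T_n` is
`2^{n-1} b_n`; hence if `p = Σ a_j x^j = Σ b_j T_j` then `b_n = 2^{-(n-1)} a_n` (`n ≥ 1`; for
`n = 0` both sides read `b_0`). [cite: Rivlin1974, Sect. 1.2 Ex. 1.2.6] -/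
theorem coeff_sum_C_mul_chebyshevT [IsDomain R] [NeZero (2 : R)] (b : ℕ → R) (n : ℕ) :
    (∑ j ∈ range (n + 1), C (b j) * T R j).coeff n = 2 ^ (n - 1) * b n := by
  rw [finsetSum_coeff, sum_range_succ, coeff_C_mul]
  have hlow : ∑ j ∈ range n, (C (b j) * T R j).coeff n = 0 := by
    refine sum_eq_zero fun j hj => ?_
    rw [coeff_C_mul, coeff_eq_zero_of_natDegree_lt, mul_zero]
    rw [natDegree_T]
    simpa using mem_range.mp hj
  have htop : (T R n).coeff n = 2 ^ (n - 1) := by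
    have h := leadingCoeff_T R n
    rwa [leadingCoeff, natDegree_T, Int.natAbs_natCast] at h
  rw [hlow, zero_add, htop, mul_comm]

/-- Ex. 1.2.6, as stated: if `p = b_0 + b_1 T_1 + ⋯ + b_n T_n` then `a_n = 2^{n-1} b_n`, i.e.
`b_n = 2^{-(n-1)} a_n`. [cite: Rivlin1974, Sect. 1.2 Ex. 1.2.6] -/
theorem coeff_eq_of_eq_sum_C_mul_chebyshevT [IsDomain R] [NeZero (2 : R)] {p : R[X]} (b : ℕ → R)
    {n : ℕ} (hp : p = ∑ j ∈ range (n + 1), C (b j) * T R j) :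
    p.coeff n = 2 ^ (n - 1) * b n := by
  rw [hp, coeff_sum_C_mul_chebyshevT R b n]

/-! ### Ex. 1.2.12: powers of `T_n` in the Chebyshev basis -/

/-- The hint of Ex. 1.2.12 (Ex. 1.1.3 with `m = n`): `2 T_n² = 1 + T_{2n}`.
[cite: Rivlin1974, Sect. 1.2 Ex. 1.2.12 (hint); Sect. 1.1 Ex. 1.1.3] -/
theorem two_mul_T_sq (n : ℤ) : 2 * T R n ^ 2 = 1 + T R (2 * n) := by
  have h := T_mul_T R n n
  rw [sub_self, T_zero] at h
  rw [sq, ← mul_assoc, h, two_mul, add_comm]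

/-- The hint of Ex. 1.2.12, division-free: `2^k T_n^{2k} = (1 + T_{2n})^k`, i.e.
`T_n^{2k} = ((1 + T_{2n})/2)^k`. [cite: Rivlin1974, Sect. 1.2 Ex. 1.2.12 (hint)] -/
theorem two_pow_mul_T_pow_two_mul (n : ℤ) (k : ℕ) :
    2 ^ k * T R n ^ (2 * k) = (1 + T R (2 * n)) ^ k := by
  rw [pow_mul, ← mul_pow, two_mul_T_sq]

/-- Ex. 1.2.12, the expansion behind it ("use Exercise 1.1.3 repeatedly"), `ℤ`-indexed and
division-free: `(2 T_n)^m = Σ_{i=0}^{m} C(m, i) T_{(m - 2i) n}`; only indices that are multiples of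
`n` by integers of the parity of `m` occur. [cite: Rivlin1974, Sect. 1.2 Ex. 1.2.12; Sect. 1.5
Ex. 1.5.31 (1.147)-(1.148)] -/
theorem two_mul_T_pow_eq_sum (n : ℤ) (m : ℕ) :
    (2 * T R n) ^ m
      = ∑ k ∈ range (m + 1), ((m.choose k : ℕ) : R[X]) * T R (((m : ℤ) - 2 * k) * n) := by
  have h := congr_arg (fun p => p.comp (T R n))
    (Literature.Algebra.Polynomial.ChebyshevPowerExpansion.two_mul_X_pow_eq_sum_T (R := R) m)
  simp only [pow_comp, mul_comp, X_comp, Polynomial.sum_comp, natCast_comp, ofNat_comp,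
    Nat.cast_ofNat] at h
  rw [h]
  refine sum_congr rfl fun k _ => ?_
  rw [T_mul]

end CommRing

/-! ### Ex. 1.2.12: the low Chebyshev coefficients of `T_n^{2k+1}` vanish -/

/-- Orthogonality for `ℤ` indices: `∫ T_a T_b dμ_T = 0` whenever `a ≠ ± b` (Mathlib's
`integral_eval_T_real_mul_eval_T_real_measureT_of_ne` is the case `a, b ∈ ℕ`, `a ≠ b`).
[cite: Rivlin1974, Sect. 1.2 Ex. 1.2.12; Sect. 1.5 (1.92)] -/
theorem integral_T_mul_T_measureT_eq_zero {a b : ℤ} (h1 : a + b ≠ 0) (h2 : a - b ≠ 0) :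
    ∫ x, (T ℝ a).eval x * (T ℝ b).eval x ∂measureT = 0 := by
  rw [integral_eval_T_real_mul_eval_T_real_measureT, integral_eval_T_real_measureT_of_ne_zero h1,
    integral_eval_T_real_measureT_of_ne_zero h2]
  simp

/-- Ex. 1.2.12, the moments of `(2 T_n)^m` against `T_j`:
`∫ (2 T_n)^m T_j dμ_T = Σ_i C(m, i) ∫ T_{(m-2i)n} T_j dμ_T`.
[cite: Rivlin1974, Sect. 1.2 Ex. 1.2.12] -/
theorem integral_two_mul_T_pow_mul_T_measureT (n : ℤ) (m : ℕ) (j : ℤ) :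
    ∫ x, ((2 * T ℝ n) ^ m).eval x * (T ℝ j).eval x ∂measureT
      = ∑ k ∈ range (m + 1), (m.choose k : ℝ)
          * ∫ x, (T ℝ (((m : ℤ) - 2 * k) * n)).eval x * (T ℝ j).eval x ∂measureT := by
  simp_rw [two_mul_T_pow_eq_sum, eval_finsetSum, sum_mul, eval_mul, eval_natCast, mul_assoc]
  rw [integral_finsetSum]
  · refine sum_congr rfl fun k _ => ?_
    rw [integral_const_mul]
  · intro k _
    refine Integrable.const_mul ?_ _
    exact integrable_measureT (by fun_prop)

/-- Ex. 1.2.12: if `(T_n)^{2k+1} = B_0 + B_1 T_1 + ⋯ + B_{n(2k+1)} T_{n(2k+1)}` then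
`B_0 = ⋯ = B_{n-1} = 0` — in orthogonality form (`B_j` is `(2/π) ∫ p T_j dμ_T`, `(1/π)` for
`j = 0`): `∫ T_n^{2k+1} T_j dμ_T = 0` for every `j < n`. [cite: Rivlin1974, Sect. 1.2 Ex. 1.2.12] -/
theorem integral_T_pow_odd_mul_T_measureT_eq_zero {n j : ℕ} (hj : j < n) (k : ℕ) :
    ∫ x, (T ℝ n).eval x ^ (2 * k + 1) * (T ℝ j).eval x ∂measureT = 0 := by
  have h := integral_two_mul_T_pow_mul_T_measureT n (2 * k + 1) j
  have hzero : ∀ i ∈ range (2 * k + 1 + 1),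
      ∫ x, (T ℝ ((((2 * k + 1 : ℕ) : ℤ) - 2 * i) * n)).eval x * (T ℝ j).eval x ∂measureT
        = 0 := by
    intro i hi
    have hodd : (((2 * k + 1 : ℕ) : ℤ) - 2 * i) ≠ 0 := by omega
    have habs : (n : ℤ) ≤ |(((2 * k + 1 : ℕ) : ℤ) - 2 * i) * n| := by
      rw [abs_mul, Nat.abs_cast]
      exact le_mul_of_one_le_left (by positivity) (Int.one_le_abs hodd)
    have hj' : (j : ℤ) < n := by exact_mod_cast hj
    apply integral_T_mul_T_measureT_eq_zero
    · intro h0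
      have : (((2 * k + 1 : ℕ) : ℤ) - 2 * i) * n = -j := by omega
      rw [this, abs_neg, Nat.abs_cast] at habs
      omega
    · intro h0
      have : (((2 * k + 1 : ℕ) : ℤ) - 2 * i) * n = j := by omega
      rw [this, Nat.abs_cast] at habs
      omega
  rw [sum_congr rfl fun i hi => by rw [hzero i hi, mul_zero], sum_const_zero] at h
  have h2 : ∀ x, ((2 * T ℝ n) ^ (2 * k + 1)).eval x
      = 2 ^ (2 * k + 1) * (T ℝ n).eval x ^ (2 * k + 1) := fun x => by
    simp [mul_pow]
  simp_rw [h2, mul_assoc] at h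
  rw [integral_const_mul, mul_eq_zero] at h
  exact h.resolve_left (by positivity)

/-! ### Ex. 1.2.16: `(1 - x) q(x) = T_n(x) - x^{n+1}` -/

section PartialSums

variable {R : Type*} [CommRing R]

/-- The partial-sum identity behind Ex. 1.2.16, for arbitrary coefficients `a_k` and
`S_k = a_0 + ⋯ + a_k`: `(1 - X) Σ_{k ≤ n} S_k X^k = Σ_{k ≤ n} a_k X^k - S_n X^{n+1}`.
[cite: Rivlin1974, Sect. 1.2 Ex. 1.2.16] -/
theorem one_sub_X_mul_sum_partialSum (a : ℕ → R) (n : ℕ) :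
    (1 - X : R[X]) * ∑ k ∈ range (n + 1), C (∑ i ∈ range (k + 1), a i) * X ^ k
      = ∑ k ∈ range (n + 1), C (a k) * X ^ k - C (∑ i ∈ range (n + 1), a i) * X ^ (n + 1) := by
  induction n with
  | zero =>
    simp only [zero_add, sum_range_one, pow_zero, mul_one, pow_one]
    ring
  | succ n ih =>
    rw [sum_range_succ _ (n + 1), mul_add, ih, sum_range_succ (fun k => C (a k) * X ^ k) (n + 1),
      sum_range_succ a (n + 1), C_add]
    ring

/-- Ex. 1.2.16 for an arbitrary polynomial `p` with `deg p ≤ n` and `S_k = Σ_{i ≤ k} p_i`: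
`(1 - X) Σ_{k ≤ n} S_k X^k = p - p(1) X^{n+1}`. [cite: Rivlin1974, Sect. 1.2 Ex. 1.2.16] -/
theorem one_sub_X_mul_sum_partialSum_coeff (p : R[X]) {n : ℕ} (hp : p.natDegree ≤ n) :
    (1 - X : R[X]) * ∑ k ∈ range (n + 1), C (∑ i ∈ range (k + 1), p.coeff i) * X ^ k
      = p - C (p.eval 1) * X ^ (n + 1) := by
  rw [one_sub_X_mul_sum_partialSum, ← as_sum_range_C_mul_X_pow' p (Nat.lt_succ_of_le hp),
    eval_eq_sum_range' (Nat.lt_succ_of_le hp)]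
  simp

/-- Ex. 1.2.16: with `s_k^{(n)} = t_0^{(n)} + ⋯ + t_k^{(n)}` (`t_k^{(n)}` the coefficients of `T_n`)
and `q = s_0 + s_1 x + ⋯ + s_n x^n`, `(1 - x) q(x) = T_n(x) - x^{n+1}`.
[cite: Rivlin1974, Sect. 1.2 Ex. 1.2.16] -/
theorem one_sub_X_mul_sum_partialSum_T (n : ℕ) :
    (1 - X : R[X]) * ∑ k ∈ range (n + 1), C (∑ i ∈ range (k + 1), (T R n).coeff i) * X ^ k
      = T R n - X ^ (n + 1) := by
  rw [one_sub_X_mul_sum_partialSum_coeff (T R n) (natDegree_T_le R n), T_eval_one, C_1, one_mul]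

end PartialSums

end Literature.Analysis.Approximation.ChebyshevCoefficientExercises
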